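import Summits.ResolutionOfSingularities.ResolutionOfSingularities.Theorems.RadicialJungCleanModelsNSLiftStep
import HarnessLib

/-!
# Transport of a whole residue-side CHAIN of coordinate blowing ups to the model (iterated lift step)

Route `RadicialJung`, crux `CleanModels` (stmt-ResolutionOfSingularities-15917), registered skeleton `Cruxes/CleanModels/Lines/Sketch.lean`
rev 35 (sha16 de44649d8f729c3b), stub 7 `stub_cleanModelsDimGEFour`.  Explicit-unit seat `decomp-res-hand-2` g5 (structural hand); memo
`Cruxes/CleanModels/Lines/Sketch-memo-hand2-g5-stubs-5-7.md` §3 (step (S5) of the assembly `spec_localMonomialization_four_of_rankOne`).  OURS;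
structural bookkeeping, counted 0; nothing here proves resolution of singularities in characteristic `p`.

`chainTransport_of_isRsopPart` — induction on the length `n` of a residue-side chain `Sq 0 ⊆ Sq 1 ⊆ ⋯ ⊆ Sq n` of coordinate local blowing ups
(`Sq (i+1) = locAtCentre (Sq i [z̄⁽ⁱ⁾ / z̄₀⁽ⁱ⁾]) Ō`, centres part of a regular system of parameters of the local ring `Sq i`, `z̄₀⁽ⁱ⁾` of positive
`ν̄`-minimal value — the data of `ELU3Coord` in the g5 spec), each step being ✓ `liftStep_of_isRsopPart`.  OUTPUT: a finitely generated model
`A ⊆ A' ⊆ O` with the same local ring at the centre of `ν₁`, centre of `ν₁` equal to `(Y / D) · A'` for the product `D ∈ A'` of the lifts of the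
`z̄₀⁽ⁱ⁾` (`#(Y/D) = #Y`, `ν₁(D) = 0`, residue of `D` = `∏ z̄₀⁽ⁱ⁾` up to a unit of `Sq n`), and residue ring `ρ(locAtCentre A' O) = Sq n`.
[cite: NovacoskiSpivakovsky2014, §3.2]
-/

noncomputable section

set_option linter.dupNamespace false -- mandated namespace of this single-conjunct summit

open IsLocalRing
open Literature.AlgebraicGeometry.Resolution

namespace Summit.ResolutionOfSingularities.ResolutionOfSingularities.Theorems.RadicialJung.CleanModels

variable {k K : Type} [Field k] [Field K] [Algebra k K]

/-- **Chain transport.** See the module docstring. [cite: NovacoskiSpivakovsky2014, §3.2] -/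
theorem chainTransport_of_isRsopPart (O O₁ : ValuationSubring K) (hO : O ≤ O₁)
    (A : Subalgebra k K) (hA : A.toSubring ≤ O.toSubring) (hAfg : A.FG)
    (Y : Finset A.toSubring)
    (hIY : (maximalIdeal O₁).comap (Subring.inclusion (hA.trans hO)) = Ideal.span (Y : Set A.toSubring))
    (Sq : ℕ → Subring (ResidueField O₁)) (hSloc : ∀ i, IsLocalRing (Sq i))
    (hS0 : ((residue O₁).comp (Subring.inclusion ((locAtCentre_le hA).trans hO))).range = Sq 0)
    (s : ℕ → ℕ) (zb : (i : ℕ) → Fin (s i + 1) → ResidueField O₁) (hzbS : ∀ i j, zb i j ∈ Sq i) :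
    ∀ n : ℕ,
      (∀ i, i < n → (haveI := hSloc i; IsRsopPart (fun j : Fin (s i + 1) => (⟨zb i j, hzbS i j⟩ : Sq i)))) →
      (∀ i, i < n → (residueValuationSubring O O₁ hO).valuation (zb i 0) < 1) →
      (∀ i, i < n → ∀ l : Fin (s i),
        (residueValuationSubring O O₁ hO).valuation (zb i l.succ) ≤ (residueValuationSubring O O₁ hO).valuation (zb i 0)) →
      (∀ i, i < n → Sq (i + 1) =
        locAtCentre (Subring.closure ((Sq i : Set (ResidueField O₁)) ∪ Set.range fun l : Fin (s i) => zb i l.succ / zb i 0))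
          (residueValuationSubring O O₁ hO)) →
      ∃ (A' : Subalgebra k K) (hA' : A'.toSubring ≤ O.toSubring), A ≤ A' ∧ A'.FG ∧
        locAtCentre A'.toSubring O₁ = locAtCentre A.toSubring O₁ ∧
        ∃ (D : K), D ∈ A' ∧ O₁.valuation D = 1 ∧
          (∃ (hD : D ∈ O₁) (u : Sq n), IsUnit u ∧
            residue O₁ ⟨D, hD⟩ = (∏ i ∈ Finset.range n, zb i 0) * (u : ResidueField O₁)) ∧
        ∃ Y' : Finset A'.toSubring, Y'.card = Y.card ∧
          (∀ y' : A'.toSubring, y' ∈ Y' ↔ ∃ y ∈ Y, ((y : A.toSubring) : K) / D = (y' : K)) ∧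
          (maximalIdeal O₁).comap (Subring.inclusion (hA'.trans hO)) = Ideal.span (Y' : Set A'.toSubring) ∧
          ((residue O₁).comp (Subring.inclusion ((locAtCentre_le hA').trans hO))).range = Sq n := by
  classical
  intro n
  induction n with
  | zero =>
    intro _ _ _ _
    haveI := hSloc 0
    refine ⟨A, hA, le_rfl, hAfg, rfl, 1, A.one_mem, map_one _, ⟨O₁.one_mem, 1, isUnit_one, ?_⟩, Y, rfl, ?_, hIY, hS0⟩
    · rw [Finset.range_zero, Finset.prod_empty, one_mul]
      exact map_one (residue O₁)
    · intro y'
      constructor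
      · intro hy'; exact ⟨y', hy', by rw [div_one]⟩
      · rintro ⟨y, hy, hyy⟩
        rw [div_one] at hyy
        have : y = y' := Subtype.ext hyy
        exact this ▸ hy
  | succ n ih =>
    intro hrsop hzb₀ hmin hstep
    obtain ⟨An, hAnO, hAAn, hAnfg, hαn, Dn, hDnA, hDn1, ⟨hDnO₁, un, hun, hDnres⟩, Yn, hYncard, hYnmem, hIYn, hSn⟩ :=
      ih (fun i hi => hrsop i (Nat.lt_succ_of_lt hi)) (fun i hi => hzb₀ i (Nat.lt_succ_of_lt hi))
        (fun i hi => hmin i (Nat.lt_succ_of_lt hi)) (fun i hi => hstep i (Nat.lt_succ_of_lt hi))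
    haveI := hSloc n
    haveI := hSloc (n + 1)
    have hnn : n < n + 1 := Nat.lt_succ_self n
    obtain ⟨A', hA'O, hAnA', hA'fg, hα', z₀, E, hz₀An, hEAn, hE1, hz₀Q, hz₀P, ⟨hEO₁, hz₀O₁, hz₀res⟩, Y', hY'card, hY'mem, hIY', hS'⟩ :=
      liftStep_of_isRsopPart O O₁ hO An hAnO hAnfg Yn hIYn (Sq n) hSn (zb n) (hzbS n) (hrsop n hnn) (hzb₀ n hnn) (hmin n hnn)
    -- `Sq n ⊆ Sq (n+1)`
    have hSS : Sq n ≤ Sq (n + 1) := by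
      rw [hstep n hnn]
      exact fun x hx => le_locAtCentre _ _ (Subring.subset_closure (Or.inl hx))
    -- the residue of `E` is a unit of `Sq n`
    have hAnO₁ : An.toSubring ≤ O₁.toSubring := hAnO.trans hO
    have hLnO₁ : locAtCentre An.toSubring O ≤ O₁.toSubring := (locAtCentre_le hAnO).trans hO
    have hresmem : ∀ (x : K) (hx : x ∈ locAtCentre An.toSubring O), residue O₁ ⟨x, hLnO₁ hx⟩ ∈ Sq n := by
      intro x hx
      rw [← hSn]
      exact ⟨⟨x, hx⟩, rfl⟩
    have hE0 : E ≠ 0 := ne_zero_of_valuation_eq_one hE1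
    have hEL : E ∈ locAtCentre An.toSubring O := le_locAtCentre _ _ hEAn
    have hEinvL : E⁻¹ ∈ locAtCentre An.toSubring O := inv_mem_locAtCentre hEL hE1
    let uE : Sq n := ⟨residue O₁ ⟨E, hEO₁⟩, hresmem E hEL⟩
    have huE : IsUnit uE := by
      refine IsUnit.of_mul_eq_one ⟨residue O₁ ⟨E⁻¹, hLnO₁ hEinvL⟩, hresmem _ hEinvL⟩ (Subtype.ext ?_)
      change residue O₁ ⟨E, hEO₁⟩ * residue O₁ ⟨E⁻¹, hLnO₁ hEinvL⟩ = 1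
      rw [← map_mul, ← map_one (residue O₁)]
      congr 1
      exact Subtype.ext (mul_inv_cancel₀ hE0)
    -- assemble
    have hDO₁ : Dn * z₀ ∈ O₁ := O₁.mul_mem _ _ hDnO₁ hz₀O₁
    let u' : Sq (n + 1) := Subring.inclusion hSS (un * uE)
    have hu' : IsUnit u' := (hun.mul huE).map (Subring.inclusion hSS)
    refine ⟨A', hA'O, hAAn.trans hAnA', hA'fg, by rw [hα', hαn], Dn * z₀, A'.mul_mem (hAnA' hDnA) (hAnA' hz₀An),
      by rw [map_mul, hDn1, hz₀P, one_mul], ⟨hDO₁, u', hu', ?_⟩, Y', by rw [hY'card, hYncard], ?_, hIY', ?_⟩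
    · have : (⟨Dn * z₀, hDO₁⟩ : O₁) = ⟨Dn, hDnO₁⟩ * ⟨z₀, hz₀O₁⟩ := rfl
      rw [this, map_mul, hDnres, hz₀res, Finset.prod_range_succ]
      change _ = _ * ((un : ResidueField O₁) * residue O₁ ⟨E, hEO₁⟩)
      ring
    · intro y'
      rw [hY'mem]
      constructor
      · rintro ⟨yn, hyn, hyy⟩
        obtain ⟨y, hy, hyyn⟩ := (hYnmem yn).mp hyn
        exact ⟨y, hy, by rw [← hyy, ← hyyn, div_div]⟩
      · rintro ⟨y, hy, hyy⟩
        -- every `y / Dn`, `y ∈ Y`, is the value of an element of `Yn`, by counting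
        have hDn0 : Dn ≠ 0 := ne_zero_of_valuation_eq_one hDn1
        let f : A.toSubring → K := fun y => ((y : A.toSubring) : K) / Dn
        have hfinj : Function.Injective f := by
          intro a b h
          apply Subtype.ext
          have h' : ((a : A.toSubring) : K) / Dn = (b : K) / Dn := h
          rwa [div_left_inj' hDn0] at h'
        have himg : Yn.image (fun yn : An.toSubring => (yn : K)) ⊆ Y.image f := by
          intro x hx
          obtain ⟨yn, hyn, rfl⟩ := Finset.mem_image.mp hx
          obtain ⟨y₀, hy₀, h⟩ := (hYnmem yn).mp hyn
          exact Finset.mem_image.mpr ⟨y₀, hy₀, h⟩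
        have heq : Yn.image (fun yn : An.toSubring => (yn : K)) = Y.image f :=
          Finset.eq_of_subset_of_card_le himg (by
            rw [Finset.card_image_of_injective _ hfinj, Finset.card_image_of_injective _ Subtype.val_injective, hYncard])
        have hfy : f y ∈ Yn.image (fun yn : An.toSubring => (yn : K)) := by
          rw [heq]; exact Finset.mem_image.mpr ⟨y, hy, rfl⟩
        obtain ⟨yn, hyn, hfyn⟩ := Finset.mem_image.mp hfy
        refine ⟨yn, hyn, ?_⟩
        rw [hfyn]
        change ((y : A.toSubring) : K) / Dn / z₀ = _
        rw [div_div]; exact hyy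
    · rw [hS', ← hstep n hnn]

end Summit.ResolutionOfSingularities.ResolutionOfSingularities.Theorems.RadicialJung.CleanModels

end
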